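import Literature.MathematicalPhysics.QuantumLattice.GrassmannIntegralProofs
import HarnessLib

/-!
# The Wilson–Dirac operator in Kronecker form and in a spin basis diagonalising `γ₀`

* `wilsonKron ρ Γ U m r` — the Wilson–Dirac operator with an arbitrary family of spin matrices
  `Γ_μ`, written as a sum of Kronecker products `(site–colour hopping) ⊗ (r ∓ Γ_μ)` on the index
  type `(Λ × Fin N) × Fin 4`; `wilsonDirac_eq_reindex_wilsonKron` identifies the tree's
  `wilsonDirac` (chiral `γ`-matrices `euclideanGamma`, index `Λ × Fin N × Fin 4`) with it.
* `diracGamma` — the explicit spin matrices `γ'_μ = S γ_μ S⁻¹` of a basis in which `γ'₀ =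
  diag(1, 1, -1, -1)` (so `P_± = (1 ± γ₀)/2` become coordinate projections) and `γ'_k`,
  `k = 1, 2, 3`, are block off-diagonal, `γ'_k = [0, g_k; g_kᴴ, 0]` with unitary `2 × 2` blocks
  `diracBlock`; `spinChange` is `S` (with `S Sᴴ = 2`), `spinChange_mul_euclideanGamma` the
  intertwining `S γ_μ = γ'_μ S`.
* `det_wilsonDirac_eq_det_wilsonKron_diracGamma` — `det D_W` equals the determinant of the
  Kronecker-form operator with the `γ'` matrices (similar matrices).

Sources: I. Montvay, G. Münster, *Quantum Fields on a Lattice* (1994), §4.2 (4.85)–(4.89) and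
App. 8.1.2 (Dirac versus chiral representation of the `γ`-matrices). Everything here is proved;
this is the bookkeeping that lets the time-slice transfer-matrix algebra
(`Literature.LinearAlgebra.Matrix.wilsonBlock`) be applied to `wilsonDirac`. [folklore]
-/

noncomputable section

open Matrix Complex

namespace Literature.MathematicalPhysics.QuantumLattice

section QLatticeAQFT

open Literature.Probability.LatticeModels QuantumFieldTheory
open scoped Kronecker

variable {L N : ℕ} {G : Type*} [Group G] (ρ : G →* Matrix (Fin N) (Fin N) ℂ)

/-! ### Kronecker form -/

/-- The forward hopping matrix in direction `μ` on site × colour space: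
`(x, a), (y, b) ↦ [y = x + μ̂] ρ(U(x, μ))_{ab}`. [folklore] -/
def hopMatrix (U : GaugeConfig 4 L G) (μ : Fin 4) :
    Matrix (TorusSite 4 L × Fin N) (TorusSite 4 L × Fin N) ℂ :=
  Matrix.of fun p q => if q.1 = QuantumFieldTheory.Site.shift p.1 μ then ρ (U (p.1, μ)) p.2 q.2 else 0

/-- The backward hopping matrix in direction `μ`:
`(x, a), (y, b) ↦ [x = y + μ̂] ρ(U(y, μ)⁻¹)_{ab}`. [folklore] -/
def hopMatrix' (U : GaugeConfig 4 L G) (μ : Fin 4) :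
    Matrix (TorusSite 4 L × Fin N) (TorusSite 4 L × Fin N) ℂ :=
  Matrix.of fun p q => if p.1 = QuantumFieldTheory.Site.shift q.1 μ then ρ (U (q.1, μ))⁻¹ p.2 q.2 else 0

/-- **The Wilson–Dirac operator in Kronecker form** with an arbitrary family `Γ_μ` of `4 × 4`
spin matrices: `(m + 4r) 1 - ½ Σ_μ (H_μ ⊗ (r - Γ_μ) + H'_μ ⊗ (r + Γ_μ))` on `(Λ × Fin N) × Fin 4`
(Montvay–Münster (4.85)). [cite: MontvayMunster1994, §4.2.2 (4.85)] -/
def wilsonKron (Γ : Fin 4 → Matrix (Fin 4) (Fin 4) ℂ) (U : GaugeConfig 4 L G) (m r : ℝ) :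
    Matrix ((TorusSite 4 L × Fin N) × Fin 4) ((TorusSite 4 L × Fin N) × Fin 4) ℂ :=
  ((m + 4 * r : ℝ) : ℂ) • (1 : Matrix _ _ ℂ) -
    (1 / 2 : ℂ) • ∑ μ : Fin 4, (hopMatrix ρ U μ ⊗ₖ ((r : ℂ) • (1 : Matrix (Fin 4) (Fin 4) ℂ) - Γ μ) +
      hopMatrix' ρ U μ ⊗ₖ ((r : ℂ) • (1 : Matrix (Fin 4) (Fin 4) ℂ) + Γ μ))

/-- Entries of the Kronecker-form operator. [folklore] -/
theorem wilsonKron_apply (Γ : Fin 4 → Matrix (Fin 4) (Fin 4) ℂ) (U : GaugeConfig 4 L G) (m r : ℝ)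
    (x y : TorusSite 4 L) (a b : Fin N) (α β : Fin 4) :
    wilsonKron ρ Γ U m r ((x, a), α) ((y, b), β) =
      (if x = y ∧ a = b ∧ α = β then ((m + 4 * r : ℝ) : ℂ) else 0) -
        (1 / 2 : ℂ) * ∑ μ : Fin 4,
          ((if y = QuantumFieldTheory.Site.shift x μ then
              ρ (U (x, μ)) a b * ((r : ℂ) • (1 : Matrix (Fin 4) (Fin 4) ℂ) - Γ μ) α β else 0) +
            (if x = QuantumFieldTheory.Site.shift y μ then
              ρ (U (y, μ))⁻¹ a b * ((r : ℂ) • (1 : Matrix (Fin 4) (Fin 4) ℂ) + Γ μ) α β else 0)) := by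
  simp only [wilsonKron, Matrix.sub_apply, Matrix.smul_apply, Matrix.one_apply, Prod.mk.injEq,
    smul_eq_mul, mul_ite, mul_one, mul_zero, Matrix.sum_apply, Matrix.add_apply,
    Matrix.kroneckerMap_apply, hopMatrix, hopMatrix', Matrix.of_apply, ite_mul, zero_mul, and_assoc]

/-- **The tree's Wilson–Dirac operator is the Kronecker-form operator with the chiral
`γ`-matrices**, up to the associativity reindexing `Λ × (Fin N × Fin 4) ≃ (Λ × Fin N) × Fin 4`. [folklore] -/
theorem wilsonDirac_eq_reindex_wilsonKron (U : GaugeConfig 4 L G) (m r : ℝ) :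
    wilsonDirac ρ U m r = Matrix.reindex (Equiv.prodAssoc _ _ _) (Equiv.prodAssoc _ _ _)
      (wilsonKron ρ euclideanGamma U m r) := by
  ext ⟨x, a, α⟩ ⟨y, b, β⟩
  rw [Matrix.reindex_apply, Matrix.submatrix_apply, Equiv.prodAssoc_symm_apply,
    Equiv.prodAssoc_symm_apply, wilsonKron_apply]
  simp only [wilsonDirac, Matrix.of_apply, Prod.mk.injEq]
  congr 1
  congr 1
  refine Finset.sum_congr rfl fun μ _ => ?_
  congr 1 <;> split_ifs <;> ring

/-! ### Conjugating the spin factor -/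

variable [NeZero L]

/-- Conjugating the Kronecker-form operator by `1 ⊗ S` changes the spin matrices:
`(1 ⊗ S) D[Γ] = D[Γ'] (1 ⊗ S)` whenever `S Γ_μ = Γ'_μ S`. [folklore] -/
theorem one_kronecker_mul_wilsonKron {Γ Γ' : Fin 4 → Matrix (Fin 4) (Fin 4) ℂ}
    {S : Matrix (Fin 4) (Fin 4) ℂ} (hS : ∀ μ, S * Γ μ = Γ' μ * S) (U : GaugeConfig 4 L G) (m r : ℝ) :
    ((1 : Matrix (TorusSite 4 L × Fin N) (TorusSite 4 L × Fin N) ℂ) ⊗ₖ S) * wilsonKron ρ Γ U m r =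
      wilsonKron ρ Γ' U m r * ((1 : Matrix (TorusSite 4 L × Fin N) (TorusSite 4 L × Fin N) ℂ) ⊗ₖ S) := by
  have h1 : ∀ μ, S * ((r : ℂ) • (1 : Matrix (Fin 4) (Fin 4) ℂ) - Γ μ) =
      ((r : ℂ) • (1 : Matrix (Fin 4) (Fin 4) ℂ) - Γ' μ) * S := fun μ => by
    rw [Matrix.mul_sub, Matrix.sub_mul, Matrix.mul_smul, Matrix.smul_mul, Matrix.mul_one,
      Matrix.one_mul, hS]
  have h2 : ∀ μ, S * ((r : ℂ) • (1 : Matrix (Fin 4) (Fin 4) ℂ) + Γ μ) =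
      ((r : ℂ) • (1 : Matrix (Fin 4) (Fin 4) ℂ) + Γ' μ) * S := fun μ => by
    rw [Matrix.mul_add, Matrix.add_mul, Matrix.mul_smul, Matrix.smul_mul, Matrix.mul_one,
      Matrix.one_mul, hS]
  simp only [wilsonKron, Matrix.mul_sub, Matrix.sub_mul, Matrix.mul_smul, Matrix.smul_mul,
    Matrix.mul_one, Matrix.one_mul, Matrix.mul_sum, Matrix.sum_mul, Matrix.mul_add, Matrix.add_mul]
  congr 2
  refine Finset.sum_congr rfl fun μ _ => ?_
  rw [← Matrix.mul_kronecker_mul, ← Matrix.mul_kronecker_mul, ← Matrix.mul_kronecker_mul,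
    ← Matrix.mul_kronecker_mul, Matrix.one_mul, Matrix.mul_one, Matrix.one_mul, Matrix.mul_one, h1, h2]

/-! ### The Dirac-type spin basis: `γ₀` diagonal -/

/-- The change of spin basis `S` (rows = conjugate eigenvectors of the chiral `γ₀`, unnormalised:
`S Sᴴ = 2`). [folklore] -/
def spinChange : Matrix (Fin 4) (Fin 4) ℂ :=
  !![1, 0, 0, -I; 0, 1, -I, 0; 1, 0, 0, I; 0, 1, I, 0]

/-- The inverse `S⁻¹ = ½ Sᴴ` of the change of spin basis. [folklore] -/
def spinChangeInv : Matrix (Fin 4) (Fin 4) ℂ :=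
  (1 / 2 : ℂ) • !![1, 0, 1, 0; 0, 1, 0, 1; 0, I, 0, -I; I, 0, -I, 0]

/-- The `γ`-matrices in the new spin basis, `γ'_μ = S γ_μ S⁻¹`: `γ'₀ = diag(1, 1, -1, -1)` and
`γ'_k = [0, g_k; g_kᴴ, 0]` for `k = 1, 2, 3` (a Dirac-type representation, time = direction `0`;
Montvay–Münster App. 8.1.2). [cite: MontvayMunster1994, App. 8.1.2] -/
def diracGamma : Fin 4 → Matrix (Fin 4) (Fin 4) ℂ :=
  ![!![1, 0, 0, 0; 0, 1, 0, 0; 0, 0, -1, 0; 0, 0, 0, -1],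
    !![0, 0, I, 0; 0, 0, 0, -I; -I, 0, 0, 0; 0, I, 0, 0],
    !![0, 0, 0, -1; 0, 0, 1, 0; 0, 1, 0, 0; -1, 0, 0, 0],
    !![0, 0, 0, -I; 0, 0, -I, 0; 0, I, 0, 0; I, 0, 0, 0]]

/-- The off-diagonal `2 × 2` blocks `g_k` of `γ'_{k+1}` (`k = 0, 1, 2`), unitary. [folklore] -/
def diracBlock : Fin 3 → Matrix (Fin 2) (Fin 2) ℂ :=
  ![!![I, 0; 0, -I], !![0, -1; 1, 0], !![0, -I; -I, 0]]

/-- `S S⁻¹ = 1`. [folklore] -/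
theorem spinChange_mul_spinChangeInv : spinChange * spinChangeInv = 1 := by
  ext i j
  fin_cases i <;> fin_cases j <;>
    simp [spinChange, spinChangeInv, Matrix.mul_apply, Fin.sum_univ_four] <;> ring_nf <;>
    simp [Complex.ext_iff] <;> norm_num

/-- **The intertwining relation** `S γ_μ = γ'_μ S` between the chiral `γ`-matrices of the tree
and the Dirac-type ones. [cite: MontvayMunster1994, App. 8.1.2] -/
theorem spinChange_mul_euclideanGamma (μ : Fin 4) :
    spinChange * euclideanGamma μ = diracGamma μ * spinChange := by
  fin_cases μ <;>
    simp only [Fin.zero_eta, Fin.mk_one, Fin.reduceFinMk, euclideanGamma_zero, euclideanGamma_one,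
      euclideanGamma_two, euclideanGamma_three, diracGamma, spinChange] <;>
    ext i j <;> fin_cases i <;> fin_cases j <;>
    simp [Matrix.mul_apply, Fin.sum_univ_four, Matrix.cons_val', Matrix.cons_val_zero, Matrix.cons_val_one]

/-- **The Wilson fermion determinant in the Dirac-type spin basis**: `det D_W[U]` equals the
determinant of the Kronecker-form operator with the `γ'`-matrices (conjugation by `1 ⊗ S`). [folklore] -/
theorem det_wilsonDirac_eq_det_wilsonKron_diracGamma (U : GaugeConfig 4 L G) (m r : ℝ) :
    (wilsonDirac ρ U m r).det = (wilsonKron ρ diracGamma U m r).det := by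
  rw [wilsonDirac_eq_reindex_wilsonKron, Matrix.det_reindex_self]
  have h := congrArg Matrix.det (one_kronecker_mul_wilsonKron ρ spinChange_mul_euclideanGamma U m r)
  rw [Matrix.det_mul, Matrix.det_mul, mul_comm (wilsonKron ρ diracGamma U m r).det] at h
  have hS : IsUnit spinChange.det := Matrix.isUnit_det_of_right_inverse spinChange_mul_spinChangeInv
  have hd : ((1 : Matrix (TorusSite 4 L × Fin N) (TorusSite 4 L × Fin N) ℂ) ⊗ₖ spinChange).det ≠ 0 := by
    rw [Matrix.det_kronecker, Matrix.det_one, one_pow, one_mul]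
    exact pow_ne_zero _ hS.ne_zero
  exact mul_left_cancel₀ hd h

end QLatticeAQFT

end Literature.MathematicalPhysics.QuantumLattice

end
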